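import Literature.NumberTheory.QuadraticFields.IntegralBasisConjugation
import Literature.NumberTheory.QuadraticFields.RealQuadraticUnits
import Mathlib.NumberTheory.NumberField.Units.DirichletTheorem
import HarnessLib

/-!
# Units modulo cubes in a quadratic field: `#(U_K/U_K³) = 1` for `d_K < −4`, `= 3` for `d_K > 0` (Bhargava–Varma, Lemma 13; HCL I, Cor. 15)

Topic `NumberTheory/QuadraticFields`, namespace `Literature.NumberTheory.QuadraticFields.Quadratic`
(continuing `IntegralBasisConjugation.lean`: `TauData`, `N(x) = xσx`; and `RealQuadraticUnits.lean`:
unit rank `1` and `w_K = 2` for `d_K > 0`). The unit index in Bhargava's count of binary cubic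
forms of discriminant `d_K` (HCL I Cor. 14–15: "the cardinality of the kernel is `|U/U³|` …
equal to `1` if `D < −3`; and `3` if `D ≥ −3`"; Bhargava–Varma Lemma 13 / Cor. 14 with
`U⁺/U⁺³`, of the same size):

* `norm_eq_of_coords` — `N(a + bτ) = a² + εab − mb²` (`4N = (2a + εb)² − d_K b²`);
* `units_eq_one_or_neg_one` — for `d_K < −4` every unit is `±1`;
* `cubes` — the subgroup `U³ ≤ U = (𝓞 K)ˣ`; `natCard_units_mod_cubes_of_discr_lt` —
  **`#(U/U³) = 1` for `d_K < −4`** (`±1` are cubes);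
* `natCard_units_mod_cubes_of_discr_pos` — **`#(U/U³) = 3` for `d_K > 0`**: with Mathlib's
  Dirichlet unit theorem (`basisModTorsion`, rank `1`) the exponent of a unit on the fundamental
  unit modulo `3` is a surjective homomorphism `U → ℤ/3` with kernel `U³` (torsion `±1 ⊆ U³`).

Everything is proved. (`d_K = −3, −4` — `#(U/U³) = 3, 1` — are not needed downstream and not
treated.)

## References

* M. Bhargava, *Higher composition laws I*, Ann. of Math. 159 (2004), Cor. 14–15 [Bhargava2004HCL1].
* M. Bhargava, I. Varma, Proc. LMS 112 (2016) = arXiv:1401.5875, Lemma 13, Cor. 14 [BhargavaVarma2016].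
-/

noncomputable section

open scoped Classical

open Module NumberField NumberField.Units

namespace Literature.NumberTheory.QuadraticFields.Quadratic

variable {K : Type*} [Field K] [NumberField K]

namespace TauData

variable (T : TauData K)

/-- **`N(a + bτ) = a² + εab − mb²`.** [folklore] -/
theorem norm_eq_of_coords (h2 : finrank ℚ K = 2) {x : 𝓞 K} {a b : ℤ}
    (hx : x = (a : 𝓞 K) + (b : 𝓞 K) * T.τ) : Algebra.norm ℤ x = a ^ 2 + T.ε * a * b - T.m * b ^ 2 := by
  have h := T.coe_norm h2 x
  rw [T.σ_coe_of_coords h2 hx] at h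
  have hxK : (x : K) = (a : K) + (b : K) * (T.τ : K) := by
    have := congrArg (algebraMap (𝓞 K) K) hx
    simp only [map_add, map_mul, map_intCast] at this
    simp only [← RingOfIntegers.coe_eq_algebraMap] at this
    exact this
  have hτK : ((T.τ : 𝓞 K) : K) * ((T.ε : K) - (T.τ : K)) = -(T.m : K) := by
    have := congrArg (algebraMap (𝓞 K) K) T.τ_sq
    simp only [map_mul, map_add, map_intCast] at this
    rw [← RingOfIntegers.coe_eq_algebraMap] at this
    linear_combination -this
  rw [hxK] at h
  have h' : ((Algebra.norm ℤ x : ℤ) : K) = ((a ^ 2 + T.ε * a * b - T.m * b ^ 2 : ℤ) : K) := by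
    rw [h]; push_cast; linear_combination ((b : K) ^ 2) * hτK
  exact_mod_cast h'

include T in
/-- **For `d_K < −4` the only units are `±1`** (`4 = (2a + εb)² + |d_K| b²` forces `b = 0`).
[cite: BhargavaVarma2016, Lemma 13 (proof: unit group of order 2 or 4 for imaginary quadratic orders ≠ ℤ[√−3], ℤ[i])] -/
theorem units_eq_one_or_neg_one (h2 : finrank ℚ K = 2) (hD : NumberField.discr K < -4) (u : (𝓞 K)ˣ) :
    (u : 𝓞 K) = 1 ∨ (u : 𝓞 K) = -1 := by
  obtain ⟨a, b, hab⟩ := T.exists_int_coords (u : 𝓞 K)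
  have hN := T.norm_eq_of_coords h2 hab
  have hunit : IsUnit (Algebra.norm ℤ (u : 𝓞 K)) := u.isUnit.map _
  rw [hN, Int.isUnit_iff] at hunit
  have hDε : NumberField.discr K = T.ε + 4 * T.m := T.discr_eq
  have hε := T.ε_eq
  have key : (2 * a + T.ε * b) ^ 2 - NumberField.discr K * b ^ 2 = 4 * (a ^ 2 + T.ε * a * b - T.m * b ^ 2) := by
    rw [hDε]; rcases hε with h | h <;> rw [h] <;> ring
  have hb : b = 0 := by
    by_contra hb
    have hb2 : 1 ≤ b ^ 2 := by nlinarith [sq_nonneg b, Int.one_le_abs hb, sq_abs b]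
    rcases hunit with h | h <;> rw [h] at key <;> nlinarith [sq_nonneg (2 * a + T.ε * b)]
  subst hb
  have ha : a ^ 2 = 1 := by rcases hunit with h | h <;> nlinarith
  have : a = 1 ∨ a = -1 := by
    have h3 : (a - 1) * (a + 1) = 0 := by linear_combination ha
    rcases mul_eq_zero.mp h3 with h | h
    · left; linarith
    · right; linarith
  rcases this with rfl | rfl
  · left; rw [hab]; push_cast; ring
  · right; rw [hab]; push_cast; ring

end TauData

/-! ### The cube subgroup -/

omit [NumberField K] in
/-- The subgroup `U³` of cubes of units of `𝓞 K`. [folklore] -/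
abbrev unitCubes (K : Type*) [Field K] : Subgroup (𝓞 K)ˣ := (powMonoidHom 3 : (𝓞 K)ˣ →* (𝓞 K)ˣ).range

/-- **`#(U/U³) = 1` for `d_K < −4`**: `±1` are cubes, so `U³ = U`. [cite: Bhargava2004HCL1, Corollary 15 (kernel of size 1 for D < −3)] -/
theorem natCard_units_mod_cubes_of_discr_lt (h2 : finrank ℚ K = 2) (hD : NumberField.discr K < -4) :
    Nat.card ((𝓞 K)ˣ ⧸ unitCubes K) = 1 := by
  obtain ⟨T⟩ := nonempty_tauData (K := K) h2
  have htop : unitCubes K = ⊤ := by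
    rw [eq_top_iff]
    intro u _
    refine ⟨u, ?_⟩
    rw [powMonoidHom_apply]
    rcases TauData.units_eq_one_or_neg_one T h2 hD u with h | h
    · have : u = 1 := Units.ext h
      rw [this, one_pow]
    · have : u = -1 := Units.ext (by rw [h]; rfl)
      rw [this]; norm_num
  rw [← Subgroup.index_eq_card, htop, Subgroup.index_top]

/-! ### Real quadratic fields: `#(U/U³) = 3` -/

section Real

variable (h2 : finrank ℚ K = 2) (hD : 0 < NumberField.discr K)
include h2 hD

/-- For `d_K > 0` the torsion units are `±1` (`w_K = 2`). [folklore] -/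
theorem mem_torsion_iff_of_discr_pos (ζ : (𝓞 K)ˣ) : ζ ∈ torsion K ↔ ζ = 1 ∨ ζ = -1 := by
  have hneg : (-1 : (𝓞 K)ˣ) ∈ torsion K :=
    (CommGroup.mem_torsion (-1 : (𝓞 K)ˣ)).mpr (isOfFinOrder_iff_pow_eq_one.mpr ⟨2, two_pos, by norm_num⟩)
  constructor
  · intro hζ
    have hcard : Nat.card (torsion K) = 2 := torsionOrder_eq_two_of_discr_pos h2 hD
    have hne : (⟨1, one_mem _⟩ : torsion K) ≠ ⟨-1, hneg⟩ := by
      intro h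
      have h' : ((1 : (𝓞 K)ˣ) : 𝓞 K) = ((-1 : (𝓞 K)ˣ) : 𝓞 K) := congrArg (fun z : torsion K => ((z : (𝓞 K)ˣ) : 𝓞 K)) h
      norm_num at h'
    obtain ⟨x, y, hxy, huniv⟩ := Nat.card_eq_two_iff.mp hcard
    have hmem : ∀ z : torsion K, z = x ∨ z = y := fun z => by
      have : z ∈ ({x, y} : Set (torsion K)) := by rw [huniv]; trivial
      simpa using this
    have key : ∀ z : torsion K, z = ⟨1, one_mem _⟩ ∨ z = ⟨-1, hneg⟩ := by
      intro z
      rcases hmem ⟨1, one_mem _⟩ with h1 | h1 <;> rcases hmem ⟨-1, hneg⟩ with hm | hm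
      · exact absurd (h1.trans hm.symm) hne
      · rcases hmem z with h | h
        · left; exact h.trans h1.symm
        · right; exact h.trans hm.symm
      · rcases hmem z with h | h
        · right; exact h.trans hm.symm
        · left; exact h.trans h1.symm
      · exact absurd (h1.trans hm.symm) hne
    rcases key ⟨ζ, hζ⟩ with h | h
    · left; exact congrArg Subtype.val h
    · right; exact congrArg Subtype.val h
  · rintro (rfl | rfl)
    · exact one_mem _
    · exact hneg

/-- The index `0 : Fin (rank K)` (`rank K = 1`). [folklore] -/
def idx : Fin (rank K) := ⟨0, by rw [rank_eq_one_of_discr_pos h2 hD]; exact Nat.one_pos⟩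

/-- In rank `1` every index is `idx`. [folklore] -/
theorem fin_eq_idx (i : Fin (rank K)) : i = idx h2 hD := by
  apply Fin.ext
  have hi := i.2
  have hr := rank_eq_one_of_discr_pos h2 hD
  simp only [idx]
  omega

/-- The Dirichlet decomposition `x = ζ · ∏ᵢ εᵢ^{eᵢ}` of a unit (Mathlib's
`exist_unique_eq_mul_prod`), as a chosen pair. [folklore] -/
def dirichletRepr (x : (𝓞 K)ˣ) : torsion K × (Fin (rank K) → ℤ) :=
  (exist_unique_eq_mul_prod K x).exists.choose

omit h2 hD in
/-- The defining property of `dirichletRepr`. [folklore] -/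
theorem dirichletRepr_spec (x : (𝓞 K)ˣ) :
    x = (dirichletRepr x).1 * ∏ i, fundSystem K i ^ (dirichletRepr x).2 i :=
  (exist_unique_eq_mul_prod K x).exists.choose_spec

omit h2 hD in
/-- Uniqueness of the Dirichlet decomposition. [folklore] -/
theorem dirichletRepr_unique {x : (𝓞 K)ˣ} {ζ : torsion K} {e : Fin (rank K) → ℤ}
    (h : x = ζ * ∏ i, fundSystem K i ^ e i) : dirichletRepr x = (ζ, e) :=
  (exist_unique_eq_mul_prod K x).unique (dirichletRepr_spec x) h

/-- The exponent of a unit on the fundamental unit. [folklore] -/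
def expnt (u : (𝓞 K)ˣ) : ℤ := (dirichletRepr u).2 (idx h2 hD)

/-- `expnt` is additive. [folklore] -/
theorem expnt_mul (u v : (𝓞 K)ˣ) : expnt h2 hD (u * v) = expnt h2 hD u + expnt h2 hD v := by
  have hu := dirichletRepr_spec u
  have hv := dirichletRepr_spec v
  have huv : u * v = ((dirichletRepr u).1 * (dirichletRepr v).1 : torsion K)
      * ∏ i, fundSystem K i ^ ((dirichletRepr u).2 i + (dirichletRepr v).2 i) := by
    conv_lhs => rw [hu, hv]
    rw [Subgroup.coe_mul]
    simp_rw [zpow_add, Finset.prod_mul_distrib]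
    simp only [mul_assoc, mul_left_comm]
  simp only [expnt, dirichletRepr_unique huv]

/-- `expnt 1 = 0`. [folklore] -/
theorem expnt_one : expnt h2 hD 1 = 0 := by
  have := expnt_mul h2 hD 1 1
  rw [one_mul] at this
  linarith

/-- The fundamental unit has exponent `1`. [folklore] -/
theorem expnt_fundSystem : expnt h2 hD (fundSystem K (idx h2 hD)) = 1 := by
  have h : fundSystem K (idx h2 hD) = ((1 : torsion K) : (𝓞 K)ˣ) * ∏ i, fundSystem K i ^ (fun _ => (1 : ℤ)) i := by
    rw [Subgroup.coe_one, one_mul]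
    rw [Finset.prod_eq_single (idx h2 hD) (fun i _ hi => absurd (fin_eq_idx h2 hD i) hi) (by simp)]
    simp
  simp only [expnt, dirichletRepr_unique h]

/-- A unit is `ζ · ε^{expnt}`. [folklore] -/
theorem eq_torsion_mul_zpow (u : (𝓞 K)ˣ) :
    u = ((dirichletRepr u).1 : (𝓞 K)ˣ) * fundSystem K (idx h2 hD) ^ expnt h2 hD u := by
  have h := dirichletRepr_spec u
  rw [Finset.prod_eq_single (idx h2 hD) (fun i _ hi => absurd (fin_eq_idx h2 hD i) hi) (by simp)] at h
  exact h

/-- **The exponent modulo `3`**, a homomorphism `U → ℤ/3`. [folklore] -/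
def expMod3 : (𝓞 K)ˣ →* Multiplicative (ZMod 3) where
  toFun u := Multiplicative.ofAdd ((expnt h2 hD u : ℤ) : ZMod 3)
  map_one' := by rw [expnt_one, Int.cast_zero, ofAdd_zero]
  map_mul' u v := by rw [expnt_mul, Int.cast_add, ofAdd_add]

/-- `expnt (ε^n) = n`. [folklore] -/
theorem expnt_fundSystem_zpow (n : ℤ) : expnt h2 hD (fundSystem K (idx h2 hD) ^ n) = n := by
  have hhom : ∀ (m : ℕ), expnt h2 hD (fundSystem K (idx h2 hD) ^ m) = m := by
    intro m
    induction m with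
    | zero => simp [expnt_one]
    | succ m ih => rw [pow_succ, expnt_mul, ih, expnt_fundSystem]; push_cast; ring
  rcases Int.eq_nat_or_neg n with ⟨m, rfl | rfl⟩
  · exact_mod_cast hhom m
  · rw [zpow_neg, zpow_natCast]
    have h0 : expnt h2 hD (fundSystem K (idx h2 hD) ^ m) + expnt h2 hD (fundSystem K (idx h2 hD) ^ m)⁻¹ = 0 := by
      rw [← expnt_mul, mul_inv_cancel, expnt_one]
    rw [hhom] at h0
    linarith

/-- `expMod3` is surjective (the fundamental unit maps to a generator). [folklore] -/
theorem expMod3_surjective : Function.Surjective (expMod3 h2 hD) := by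
  intro t
  refine ⟨fundSystem K (idx h2 hD) ^ ((Multiplicative.toAdd t : ZMod 3).val : ℤ), ?_⟩
  simp only [expMod3, MonoidHom.coe_mk, OneHom.coe_mk, expnt_fundSystem_zpow, Int.cast_natCast,
    ZMod.natCast_zmod_val, ofAdd_toAdd]

/-- **The kernel of `expMod3` is `U³`.** [folklore] -/
theorem ker_expMod3 : (expMod3 h2 hD).ker = unitCubes K := by
  ext u
  rw [MonoidHom.mem_ker]
  constructor
  · intro hu
    simp only [expMod3, MonoidHom.coe_mk, OneHom.coe_mk] at hu
    rw [← ofAdd_zero, Multiplicative.ofAdd.injective.eq_iff, ZMod.intCast_zmod_eq_zero_iff_dvd] at hu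
    obtain ⟨k, hk⟩ := hu
    have hdec := eq_torsion_mul_zpow h2 hD u
    rw [hk] at hdec
    rcases (mem_torsion_iff_of_discr_pos h2 hD _).mp (dirichletRepr u).1.2 with hz | hz
    · refine ⟨fundSystem K (idx h2 hD) ^ k, ?_⟩
      rw [powMonoidHom_apply, hdec, hz, one_mul, ← zpow_natCast, ← zpow_mul, mul_comm]
    · refine ⟨-(fundSystem K (idx h2 hD) ^ k), ?_⟩
      rw [powMonoidHom_apply, hdec, hz, neg_pow, ← zpow_natCast (fundSystem K _ ^ k), ← zpow_mul, mul_comm k]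
      norm_num
  · rintro ⟨v, rfl⟩
    simp only [expMod3, MonoidHom.coe_mk, OneHom.coe_mk, powMonoidHom_apply]
    rw [← ofAdd_zero, Multiplicative.ofAdd.injective.eq_iff]
    have : expnt h2 hD (v ^ 3) = 3 * expnt h2 hD v := by
      rw [pow_succ, pow_two, expnt_mul, expnt_mul]; ring
    rw [this]; push_cast
    rw [show (3 : ZMod 3) = 0 from rfl, zero_mul]

/-- **`#(U/U³) = 3` for a real quadratic field** (`U ≅ {±1} × ℤ`). [cite: Bhargava2004HCL1, Corollary 15 (kernel of size 3 for D > 0)] -/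
theorem natCard_units_mod_cubes_of_discr_pos : Nat.card ((𝓞 K)ˣ ⧸ unitCubes K) = 3 := by
  have e := (QuotientGroup.quotientMulEquivOfEq (ker_expMod3 h2 hD).symm).trans
    (QuotientGroup.quotientKerEquivOfSurjective (expMod3 h2 hD) (expMod3_surjective h2 hD))
  rw [Nat.card_congr e.toEquiv, Nat.card_eq_fintype_card]
  rfl

end Real

end Literature.NumberTheory.QuadraticFields.Quadratic

end
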